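import Mathlib
import HarnessLib
import HarnessLib.Audit
import Summits.AnomalousDissipation.Statement
import Summits.AnomalousDissipation.AnomalousDissipation.Theses.TwoAndHalfD

/-!
# Record of the dropped route items `TwoAndHalfD.ScalarLift2halfD` (stmt-AnomalousDissipation-14324) and `TwoAndHalfD.ScalarLiftGlue` (stmt-AnomalousDissipation-14325)

Route `AnomalousDissipation/TwoAndHalfD` dropped its support items `ScalarLift2halfD`
(stmt-AnomalousDissipation-14324) and `ScalarLiftGlue` (stmt-AnomalousDissipation-14325) at rev 9
(2026-08-16T07:03:43Z, route-choice unit `rchoice-AnomalousDissipation-TwoAndHal-211b03f8`) after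
`ScalarLift2halfD` was closed `refuted` (MISSTATED: unconstrained, possibly non-measurable planar
datum `v₀`) by
`Summit.AnomalousDissipation.AnomalousDissipation.Theorems.not_ScalarLift2halfD`
(`Theorems/TwoAndHalfDScalarLift2halfDRefutation.lean`), and `ScalarLiftGlue` — proved by
`Summit.AnomalousDissipation.AnomalousDissipation.Theorems.scalarLiftGlue_proof`
(`Theorems/TwoAndHalfDScalarLiftGlue.lean`) but vacuous, its third hypothesis being refuted — was
replaced by the repaired pair `ScalarLift2halfDR` / `ScalarLiftGlueR`. The gate-written route file
`Theses/TwoAndHalfD.lean` therefore no longer declares the two constants, while the refutation and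
the glue proof — Theorems files, append-only, whose statement texts
`¬ …Theses.TwoAndHalfD.ScalarLift2halfD` and `…Theses.TwoAndHalfD.ScalarLiftGlue` may not change —
still name them, so both modules stopped building ("Unknown identifier", full build of
2026-08-16T23:32Z). This module re-declares the two constants under their ORIGINAL fully-qualified
names with their ORIGINAL definientia (the items' ledger signatures, verbatim), in the route file's
namespace and `open` context, so that the two records elaborate again; it is imported by those two
files only (one added import line each; pattern `Theorems/DebrisQuantaRobustDecayQuantumRecord.lean`,
announced by the planner in the evidence file `TwoAndHalfDScalarLiftRecord.lean` on
stmt-AnomalousDissipation-14324). Neither constant is a route item (no `route_item` attribute);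
`ScalarLift2halfD` is FALSE (see the refutation) and `ScalarLiftGlue` is TRUE but vacuous.
-/

namespace Summit.AnomalousDissipation.AnomalousDissipation.Theses.TwoAndHalfD

open scoped BigOperators Topology Manifold Classical MeasureTheory ProbabilityTheory Matrix InnerProductSpace ComplexConjugate ContinuousMap
open Filter Set Function TopologicalSpace MeasureTheory
open Literature.Turb

/-- **Record of the dropped route item `ScalarLift2halfD`** = stmt-AnomalousDissipation-14324
(ledger signature verbatim; NOT a route item; FALSE —
`Theorems.not_ScalarLift2halfD`): the `2½`-dimensional lift as originally filed — for `ν > 0`,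
`g` smooth divergence-free, `h` smooth, `θ₀ ∈ L²(𝕋²)` and a planar global Leray–Hopf solution `v`
with force `g` from an ARBITRARY datum `v₀`, existence of a global weak sourced scalar `θ` from
`θ₀` such that `t ↦ twoHalf (v t) (θ t)` is a global Leray–Hopf solution on `𝕋³` with force
`twoHalf g h` from the datum `twoHalf v₀ θ₀`; refuted because the Leray–Hopf class sees `v₀` only
through Bochner integrals and a lower integral, so a non-measurable junk `v₀` satisfies the
hypothesis while the lifted datum breaks the conclusion. Repaired successor (route item, proved):
`ScalarLift2halfDR` (restart form). Re-declared only so that the refutation record keeps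
elaborating (see the module docstring). -/
def ScalarLift2halfD : Prop :=
  ∀ (ν : ℝ) (g : UnitAddTorus (Fin 2) → EuclideanSpace ℝ (Fin 2)) (h : UnitAddTorus (Fin 2) → ℝ) (v₀ : UnitAddTorus (Fin 2) → EuclideanSpace ℝ (Fin 2)) (v : ℝ → UnitAddTorus (Fin 2) → EuclideanSpace ℝ (Fin 2)) (θ₀ : UnitAddTorus (Fin 2) → ℝ), 0 < ν → Literature.Analysis.FunctionSpaces.Torus.IsSmooth g → Literature.Analysis.FunctionSpaces.Torus.IsDivFree g → Literature.Analysis.FunctionSpaces.Torus.IsSmooth h → MeasureTheory.MemLp θ₀ 2 MeasureTheory.volume → Literature.Analysis.FluidPDE.Torus.IsGlobalLerayHopf ν (fun _ => g) v₀ v → ∃ θ : ℝ → UnitAddTorus (Fin 2) → ℝ, Literature.Analysis.FluidPDE.Torus.IsWeakScalarTransportForced ν v (fun _ => h) θ₀ θ ∧ Literature.Analysis.FluidPDE.Torus.IsGlobalLerayHopf ν (fun _ => Literature.Analysis.FunctionSpaces.Torus.twoHalf g h) (Literature.Analysis.FunctionSpaces.Torus.twoHalf v₀ θ₀) (fun t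 => Literature.Analysis.FunctionSpaces.Torus.twoHalf (v t) (θ t))

/-- **Record of the dropped route item `ScalarLiftGlue`** = stmt-AnomalousDissipation-14325
(ledger signature verbatim; NOT a route item; TRUE but vacuous —
`Theorems.scalarLiftGlue_proof`, its hypothesis `ScalarLift2halfD` being refuted): the original
crux-to-target glue `ScalarAnomalySteadySourceFormal → SourcedScalarUnique2D → ScalarLift2halfD →
TwohalfdThesis`. Repaired successor (route item, proved): `ScalarLiftGlueR`. Re-declared only so
that the glue record keeps elaborating (see the module docstring). -/
def ScalarLiftGlue : Prop :=
  ScalarAnomalySteadySourceFormal → SourcedScalarUnique2D → ScalarLift2halfD → TwohalfdThesis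

end Summit.AnomalousDissipation.AnomalousDissipation.Theses.TwoAndHalfD
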